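import Literature.Probability.RandomPlanarGeometry.RadialChordalMoebius
import Literature.Probability.RandomPlanarGeometry.RadialLoewnerDiscMaps
import Literature.Probability.RandomPlanarGeometry.LoewnerFlow
import Mathlib.MeasureTheory.Integral.IntervalIntegral.FundThmCalculus
import Mathlib.Analysis.SpecialFunctions.ExpDeriv
import Mathlib.Analysis.SpecialFunctions.Trigonometric.Deriv
import HarnessLib

/-!
# The Schramm–Wilson coordinate change, pathwise: a radial Loewner chain read in the half-plane

Topic `Probability/RandomPlanarGeometry`; definitions with bodies and proved theorems only (no
named fact). Sequel of `RadialChordalMoebius` (the Möbius algebra). Let `V : ℝ≥0 → ℝ` be a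
continuous radial driving function (driving point `e^{iV}`, `RadialLoewner.Disc`, LSW sign
convention) and let `Y` be the **radial Bessel flow of the marked boundary point `-1`**, i.e. a
continuous solution on `[0, u₁]` of Lawler's equation (6.12)

  `Y_u = π + ∫₀ᵘ cot(Y_s/2) ds - V_u`,   `Y ∈ (0, 2π)`

(the tree's `RadialLoewner.arg V π`, `arg_eq_integral`; here an abstract hypothesis, so that the
file is independent of the probabilistic layer). From `Y` alone we build, by quadrature, the data
of the time-dependent Möbius map `m_u = moebius ζ_u λ_u` sending the chordal picture to the radial
one (Schramm–Wilson (2005), §4):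

* `phase ϑ = ∫ cot(Y/2)` (`= Y + V - π`, `phase_eq`), `imP 𝒴 = exp(-∫ 1/(2 sin²(Y/2)))`,
  `reP R = -∫ 𝒴 cos(Y/2)/(2 sin³(Y/2))`, the centre `ζ = R + i𝒴` (chordal image of the radial
  target `0`), the phase factor `λ = -e^{iϑ}` (`m₀ = toDisc`), the **chordal driving value**
  `drv W = R + 𝒴 cot(Y/2)`, the **chordal clock** `clock τ = ∫ 𝒴²/(4 sin⁴(Y/2))` and its inverse
  `invClock υ`, the rate `a = 4 sin⁴(Y/2)/𝒴² = 1/τ'`;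
* the identities `a = -(ζ - ζ̄)²/((ζ - W)²(ζ̄ - W)²)` (`rate_eq_moebiusRate`),
  `ζ' = 2/((ζ - W) a)`, `ζ̄' = 2/((ζ̄ - W) a)`, `λ' = ((ζ - W)⁻² - (ζ̄ - W)⁻²) λ / a`
  (the parameters move by the chordal Loewner field at the target, in radial time) and
  **`m_u(W_u) = e^{iV_u}`** (`drivingPt_eq_moebius`: the pole is the radial driving point);
* **the conjugation theorem** (`hasDerivWithinAt_moebiusInv`, from the polynomial identity
  `inv_conj_identity`): if `G` solves the radial Loewner equation then `z = m_u⁻¹(G)` solves the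
  chordal Loewner equation in radial time, `ż = 2/((z - W) a)`;
* in capacity time `t = τ_u`: the **chordal driving function** `cdrv W̌_t = W_{υt}` is continuous
  with `W̌₀ = 0`, the conjugated solutions are solutions of the tree's chordal Loewner chain
  (`isSolution_conjSol`, `Loewner.IsSolution`), and for every radial time `u < u₁`:
  **`Loewner.map W̌ (τ u) (toHalf w) = m_u⁻¹ (RadialLoewner.Disc.map V u w)`** on the radial
  domain, **`Loewner.domain W̌ (τ u) = toHalf '' RadialLoewner.Disc.domain V u`**
  (`map_cdrv_toHalf`, `domain_cdrv_eq`), and the inverse maps correspond (`invFunOn_map_eq`).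

This is the deterministic half of "chordal SLE_κ in `𝔻` from `1` to `-1` is a time change of
radial SLE_κ(κ - 6) with force point `-1`" (Schramm–Wilson (2005), Thm. 3 / §4; Lawler (2005),
§4.2, §6.5 Prop. 6.22 for `κ = 6`), valid for every continuous driving function; the law of `W̌`
under radial SLE_κ is identified in the probabilistic sequels.

## References

* O. Schramm, D. B. Wilson, *SLE coordinate changes*, New York J. Math. 11 (2005), 659–669, §4.
  [SchrammWilson2005]
* G. F. Lawler, *Conformally Invariant Processes in the Plane*, AMS (2005), §4.2 (radial Loewner
  equation), §6.4 eq. (6.12) (the boundary flow), §6.5 (radial vs. chordal SLE). [Lawler2005]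
-/

noncomputable section

open Complex Set Metric MeasureTheory Real Filter Topology
open scoped ComplexConjugate NNReal

namespace Literature.Probability.RandomPlanarGeometry

namespace RadialChordal

/-! ### The inverse conjugation identity (radial → chordal) -/

/-- **The field-conjugation identity, inverse form (radial → chordal).** With the notation of
`conj_identity` (`c = conj ζ` in the application, `a = -(ζ - c)²/((ζ - W)²(c - W)²)` the rate,
`ξ = λ (W - ζ)/(W - c)` the pole): if the point `G` moves by the *radial* Loewner field
`G (ξ + G)/(ξ - G)` (unit rate) while the parameters move by the chordal rates divided by `a`
(`λ̇ = ((ζ - W)⁻² - (c - W)⁻²) λ / a`, `ζ̇ = 2/((ζ - W) a)`, `ċ = 2/((c - W) a)`), then the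
preimage `z = moebiusInv ζ λ G = (c G - λ ζ)/(G - λ)` moves by the *chordal* Loewner field divided
by the rate, `ż = 2/((z - W) a)` (quotient rule made explicit on the left). A polynomial identity;
Schramm–Wilson (2005), §4 (radial SLE read in the half-plane). [cite: Lawler2005, §4.2] -/
theorem inv_conj_identity {G W ζ c lam : ℂ} (hGl : G - lam ≠ 0) (hζW : ζ - W ≠ 0) (hcW : c - W ≠ 0)
    (hWc : W - c ≠ 0) (hζc : ζ - c ≠ 0)
    (hN₁ : lam * (W - ζ) - (W - c) * G ≠ 0)
    (hN₂ : c * G - lam * ζ - (G - lam) * W ≠ 0) :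
    let a : ℂ := -(ζ - c) ^ 2 / ((ζ - W) ^ 2 * (c - W) ^ 2)
    let ξ : ℂ := lam * (W - ζ) / (W - c)
    let Gd : ℂ := G * (ξ + G) / (ξ - G)
    let lamd : ℂ := ((ζ - W)⁻¹ ^ 2 - (c - W)⁻¹ ^ 2) / a * lam
    let ζd : ℂ := 2 / (ζ - W) / a
    let cd : ℂ := 2 / (c - W) / a
    ((cd * G + c * Gd - lamd * ζ - lam * ζd) * (G - lam) - (c * G - lam * ζ) * (Gd - lamd)) / (G - lam) ^ 2 =
      2 / ((c * G - lam * ζ) / (G - lam) - W) / a := by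
  intro a ξ Gd lamd ζd cd
  have hξG : ξ - G = (lam * (W - ζ) - (W - c) * G) / (W - c) := by
    simp only [ξ]; rw [div_sub' hWc]
  have hξG' : ξ + G = (lam * (W - ζ) + G * (W - c)) / (W - c) := by
    simp only [ξ]; rw [div_add' _ _ _ hWc]
  have hnW : (c * G - lam * ζ) / (G - lam) - W = (c * G - lam * ζ - (G - lam) * W) / (G - lam) := by
    rw [div_sub' hGl]
  have hGd : Gd = G * (lam * (W - ζ) + G * (W - c)) / (lam * (W - ζ) - (W - c) * G) := by
    simp only [Gd]; rw [hξG', hξG, mul_div_assoc, mul_div_assoc, div_div_div_cancel_right₀ hWc]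
  rw [hnW, hGd]
  simp only [a, lamd, ζd, cd]
  set N₁ : ℂ := lam * (W - ζ) - (W - c) * G with hN₁def
  set N₂ : ℂ := c * G - lam * ζ - (G - lam) * W with hN₂def
  field_simp
  rw [hN₁def, hN₂def]
  ring

/-! ### The chordal data attached to an angle path `Y` (quadratures) -/

section Data

variable (Y : ℝ → ℝ) (u₁ : ℝ)

/-- Time clamped to `[0, u₁]`. [folklore] -/
def clampT (u : ℝ) : ℝ := max 0 (min u u₁)

/-- The angle path read through the clamped time (continuous on `ℝ` when `Y` is continuous on
`[0, u₁]`; equal to `Y` there). [folklore] -/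
def Ycl (u : ℝ) : ℝ := Y (clampT u₁ u)

/-- The **phase** `ϑ_u = ∫₀ᵘ cot(Y_s/2) ds` (argument of the marked boundary point minus `π`:
`ϑ = Y + V - π` by the radial Bessel equation, `phase_eq`). [cite: SchrammWilson2005, §4] -/
def phase (u : ℝ) : ℝ := ∫ s in (0 : ℝ)..u, Real.cot (Ycl Y u₁ s / 2)

/-- The **imaginary part of the centre** `𝒴_u = exp(-∫₀ᵘ ds/(2 sin²(Y_s/2)))` (the height
`im gₜ(i)` of the chordal image of the radial target, read in radial time).
[cite: SchrammWilson2005, §4] -/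
def imP (u : ℝ) : ℝ := Real.exp (-∫ s in (0 : ℝ)..u, 1 / (2 * Real.sin (Ycl Y u₁ s / 2) ^ 2))

/-- The **real part of the centre** `R_u = -∫₀ᵘ 𝒴_s cos(Y_s/2)/(2 sin³(Y_s/2)) ds`.
[cite: SchrammWilson2005, §4] -/
def reP (u : ℝ) : ℝ :=
  -∫ s in (0 : ℝ)..u, imP Y u₁ s * Real.cos (Ycl Y u₁ s / 2) / (2 * Real.sin (Ycl Y u₁ s / 2) ^ 3)

/-- The **centre** `ζ_u = R_u + i 𝒴_u` (`= gₜ(i)`, the chordal image of the radial target).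
[cite: SchrammWilson2005, §4] -/
def centre (u : ℝ) : ℂ := (reP Y u₁ u : ℂ) + (imP Y u₁ u : ℂ) * I

/-- The **phase factor** `λ_u = -exp(i ϑ_u)` of the Möbius map `moebius ζ_u λ_u`
(`λ₀ = -1`, so that the map at time `0` is `toDisc`). [cite: SchrammWilson2005, §4] -/
def lamb (u : ℝ) : ℂ := -Complex.exp ((phase Y u₁ u : ℂ) * I)

/-- The **chordal driving value in radial time** `W_u = R_u + 𝒴_u cot(Y_u/2)` (the real point sent
by `moebius ζ_u λ_u` to the radial driving point `e^{iV_u}`, `moebius_drv`).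
[cite: SchrammWilson2005, §4] -/
def drv (u : ℝ) : ℝ := reP Y u₁ u + imP Y u₁ u * Real.cot (Ycl Y u₁ u / 2)

/-- The **chordal clock** `τ_u = ∫₀ᵘ 𝒴_s²/(4 sin⁴(Y_s/2)) ds` (half-plane capacity time as a
function of radial time). [cite: SchrammWilson2005, §4] -/
def clock (u : ℝ) : ℝ := ∫ s in (0 : ℝ)..u, imP Y u₁ s ^ 2 / (4 * Real.sin (Ycl Y u₁ s / 2) ^ 4)

/-- The **rate** `a_u = 4 sin⁴(Y_u/2)/𝒴_u² = 1/τ'_u` (`= 4 (im ζ)²/|ζ - W|⁴`, `rate_eq`).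
[cite: SchrammWilson2005, §4] -/
def rate (u : ℝ) : ℝ := 4 * Real.sin (Ycl Y u₁ u / 2) ^ 4 / imP Y u₁ u ^ 2

end Data

/-! ### Continuity and derivatives of the data -/

section Calculus

variable {Y : ℝ → ℝ} {u₁ : ℝ}

/-- The clamped time lies in `[0, u₁]`. [folklore] -/
theorem clampT_mem (hu₁ : 0 ≤ u₁) (u : ℝ) : clampT u₁ u ∈ Icc 0 u₁ :=
  ⟨le_max_left _ _, max_le hu₁ (min_le_right _ _)⟩

/-- On `[0, u₁]` the clamp is the identity. [folklore] -/
theorem clampT_of_mem {u : ℝ} (hu : u ∈ Icc 0 u₁) : clampT u₁ u = u := by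
  rw [clampT, min_eq_left hu.2, max_eq_right hu.1]

/-- The clamp is continuous. [folklore] -/
theorem continuous_clampT (u₁ : ℝ) : Continuous (clampT u₁) :=
  continuous_const.max (continuous_id.min continuous_const)

/-- On `[0, u₁]` the clamped path is the path. [folklore] -/
theorem Ycl_of_mem {u : ℝ} (hu : u ∈ Icc 0 u₁) : Ycl Y u₁ u = Y u := by
  rw [Ycl, clampT_of_mem hu]

/-- `Y` at the clamped time `0`. [folklore] -/
theorem Ycl_zero (hu₁ : 0 ≤ u₁) : Ycl Y u₁ 0 = Y 0 :=
  Ycl_of_mem ⟨le_rfl, hu₁⟩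

/-- The clamped path is continuous. [folklore] -/
theorem continuous_Ycl (hu₁ : 0 ≤ u₁) (hY : ContinuousOn Y (Icc 0 u₁)) : Continuous (Ycl Y u₁) :=
  hY.comp_continuous (continuous_clampT u₁) (clampT_mem hu₁)

/-- The clamped path stays in `(0, 2π)`. [folklore] -/
theorem Ycl_mem (hu₁ : 0 ≤ u₁) (hYI : ∀ u ∈ Icc 0 u₁, Y u ∈ Ioo 0 (2 * π)) (u : ℝ) :
    Ycl Y u₁ u ∈ Ioo 0 (2 * π) :=
  hYI _ (clampT_mem hu₁ u)

/-- `sin(Y/2) > 0` along the clamped path. [folklore] -/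
theorem sin_half_Ycl_pos (hu₁ : 0 ≤ u₁) (hYI : ∀ u ∈ Icc 0 u₁, Y u ∈ Ioo 0 (2 * π)) (u : ℝ) :
    0 < Real.sin (Ycl Y u₁ u / 2) := by
  have h := Ycl_mem hu₁ hYI u
  exact Real.sin_pos_of_pos_of_lt_pi (by linarith [h.1]) (by linarith [h.2])

/-- Continuity of `u ↦ sin(Y_u/2)`. [folklore] -/
theorem continuous_sin_half (hu₁ : 0 ≤ u₁) (hY : ContinuousOn Y (Icc 0 u₁)) :
    Continuous fun u ↦ Real.sin (Ycl Y u₁ u / 2) :=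
  Real.continuous_sin.comp ((continuous_Ycl hu₁ hY).div_const 2)

/-- Continuity of `u ↦ cos(Y_u/2)`. [folklore] -/
theorem continuous_cos_half (hu₁ : 0 ≤ u₁) (hY : ContinuousOn Y (Icc 0 u₁)) :
    Continuous fun u ↦ Real.cos (Ycl Y u₁ u / 2) :=
  Real.continuous_cos.comp ((continuous_Ycl hu₁ hY).div_const 2)

/-- Continuity of `u ↦ cot(Y_u/2)`. [folklore] -/
theorem continuous_cot_half (hu₁ : 0 ≤ u₁) (hY : ContinuousOn Y (Icc 0 u₁))
    (hYI : ∀ u ∈ Icc 0 u₁, Y u ∈ Ioo 0 (2 * π)) : Continuous fun u ↦ Real.cot (Ycl Y u₁ u / 2) := by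
  have h : (fun u ↦ Real.cot (Ycl Y u₁ u / 2)) =
      fun u ↦ Real.cos (Ycl Y u₁ u / 2) / Real.sin (Ycl Y u₁ u / 2) := by
    funext u; exact Real.cot_eq_cos_div_sin _
  rw [h]
  exact (continuous_cos_half hu₁ hY).div (continuous_sin_half hu₁ hY)
    fun u ↦ (sin_half_Ycl_pos hu₁ hYI u).ne'

/-- `ϑ' = cot(Y/2)`. [folklore] -/
theorem hasDerivAt_phase (hu₁ : 0 ≤ u₁) (hY : ContinuousOn Y (Icc 0 u₁))
    (hYI : ∀ u ∈ Icc 0 u₁, Y u ∈ Ioo 0 (2 * π)) (u : ℝ) :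
    HasDerivAt (phase Y u₁) (Real.cot (Ycl Y u₁ u / 2)) u :=
  ((continuous_cot_half hu₁ hY hYI).integral_hasStrictDerivAt 0 u).hasDerivAt

/-- `ϑ` is continuous. [folklore] -/
theorem continuous_phase (hu₁ : 0 ≤ u₁) (hY : ContinuousOn Y (Icc 0 u₁))
    (hYI : ∀ u ∈ Icc 0 u₁, Y u ∈ Ioo 0 (2 * π)) : Continuous (phase Y u₁) :=
  continuous_iff_continuousAt.2 fun u ↦ (hasDerivAt_phase hu₁ hY hYI u).continuousAt

/-- `ϑ₀ = 0`. [folklore] -/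
theorem phase_zero : phase Y u₁ 0 = 0 := by
  simp [phase]

/-- The integrand of `𝒴` is continuous. [folklore] -/
theorem continuous_imP_integrand (hu₁ : 0 ≤ u₁) (hY : ContinuousOn Y (Icc 0 u₁))
    (hYI : ∀ u ∈ Icc 0 u₁, Y u ∈ Ioo 0 (2 * π)) :
    Continuous fun s ↦ 1 / (2 * Real.sin (Ycl Y u₁ s / 2) ^ 2) :=
  continuous_const.div (continuous_const.mul ((continuous_sin_half hu₁ hY).pow 2))
    fun s ↦ mul_ne_zero two_ne_zero (pow_ne_zero 2 (sin_half_Ycl_pos hu₁ hYI s).ne')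

/-- `𝒴 > 0`. [folklore] -/
theorem imP_pos (u : ℝ) : 0 < imP Y u₁ u := Real.exp_pos _

/-- `𝒴₀ = 1`. [folklore] -/
theorem imP_zero : imP Y u₁ 0 = 1 := by
  simp [imP]

/-- `𝒴' = -𝒴/(2 sin²(Y/2))`. [folklore] -/
theorem hasDerivAt_imP (hu₁ : 0 ≤ u₁) (hY : ContinuousOn Y (Icc 0 u₁))
    (hYI : ∀ u ∈ Icc 0 u₁, Y u ∈ Ioo 0 (2 * π)) (u : ℝ) :
    HasDerivAt (imP Y u₁) (-(imP Y u₁ u / (2 * Real.sin (Ycl Y u₁ u / 2) ^ 2))) u := by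
  have h1 := ((continuous_imP_integrand hu₁ hY hYI).integral_hasStrictDerivAt 0 u).hasDerivAt
  have h2 : HasDerivAt (fun x ↦ Real.exp (-∫ s in (0 : ℝ)..x, 1 / (2 * Real.sin (Ycl Y u₁ s / 2) ^ 2)))
      (Real.exp (-∫ s in (0 : ℝ)..u, 1 / (2 * Real.sin (Ycl Y u₁ s / 2) ^ 2)) *
        -(1 / (2 * Real.sin (Ycl Y u₁ u / 2) ^ 2))) u := h1.neg.exp
  refine h2.congr_deriv ?_
  rw [imP]
  ring

/-- `𝒴` is continuous. [folklore] -/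
theorem continuous_imP (hu₁ : 0 ≤ u₁) (hY : ContinuousOn Y (Icc 0 u₁))
    (hYI : ∀ u ∈ Icc 0 u₁, Y u ∈ Ioo 0 (2 * π)) : Continuous (imP Y u₁) :=
  continuous_iff_continuousAt.2 fun u ↦ (hasDerivAt_imP hu₁ hY hYI u).continuousAt

/-- The integrand of `R` is continuous. [folklore] -/
theorem continuous_reP_integrand (hu₁ : 0 ≤ u₁) (hY : ContinuousOn Y (Icc 0 u₁))
    (hYI : ∀ u ∈ Icc 0 u₁, Y u ∈ Ioo 0 (2 * π)) :
    Continuous fun s ↦ imP Y u₁ s * Real.cos (Ycl Y u₁ s / 2) / (2 * Real.sin (Ycl Y u₁ s / 2) ^ 3) :=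
  ((continuous_imP hu₁ hY hYI).mul (continuous_cos_half hu₁ hY)).div
    (continuous_const.mul ((continuous_sin_half hu₁ hY).pow 3))
    fun s ↦ mul_ne_zero two_ne_zero (pow_ne_zero 3 (sin_half_Ycl_pos hu₁ hYI s).ne')

/-- `R' = -𝒴 cos(Y/2)/(2 sin³(Y/2))`. [folklore] -/
theorem hasDerivAt_reP (hu₁ : 0 ≤ u₁) (hY : ContinuousOn Y (Icc 0 u₁))
    (hYI : ∀ u ∈ Icc 0 u₁, Y u ∈ Ioo 0 (2 * π)) (u : ℝ) :
    HasDerivAt (reP Y u₁)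
      (-(imP Y u₁ u * Real.cos (Ycl Y u₁ u / 2) / (2 * Real.sin (Ycl Y u₁ u / 2) ^ 3))) u :=
  ((continuous_reP_integrand hu₁ hY hYI).integral_hasStrictDerivAt 0 u).hasDerivAt.neg

/-- `R` is continuous. [folklore] -/
theorem continuous_reP (hu₁ : 0 ≤ u₁) (hY : ContinuousOn Y (Icc 0 u₁))
    (hYI : ∀ u ∈ Icc 0 u₁, Y u ∈ Ioo 0 (2 * π)) : Continuous (reP Y u₁) :=
  continuous_iff_continuousAt.2 fun u ↦ (hasDerivAt_reP hu₁ hY hYI u).continuousAt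

/-- `R₀ = 0`. [folklore] -/
theorem reP_zero : reP Y u₁ 0 = 0 := by
  simp [reP]

/-- The clock integrand is continuous. [folklore] -/
theorem continuous_clock_integrand (hu₁ : 0 ≤ u₁) (hY : ContinuousOn Y (Icc 0 u₁))
    (hYI : ∀ u ∈ Icc 0 u₁, Y u ∈ Ioo 0 (2 * π)) :
    Continuous fun s ↦ imP Y u₁ s ^ 2 / (4 * Real.sin (Ycl Y u₁ s / 2) ^ 4) :=
  ((continuous_imP hu₁ hY hYI).pow 2).div (continuous_const.mul ((continuous_sin_half hu₁ hY).pow 4))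
    fun s ↦ mul_ne_zero four_ne_zero (pow_ne_zero 4 (sin_half_Ycl_pos hu₁ hYI s).ne')

/-- `τ' = 𝒴²/(4 sin⁴(Y/2)) = 1/a`. [folklore] -/
theorem hasDerivAt_clock (hu₁ : 0 ≤ u₁) (hY : ContinuousOn Y (Icc 0 u₁))
    (hYI : ∀ u ∈ Icc 0 u₁, Y u ∈ Ioo 0 (2 * π)) (u : ℝ) :
    HasDerivAt (clock Y u₁) (imP Y u₁ u ^ 2 / (4 * Real.sin (Ycl Y u₁ u / 2) ^ 4)) u :=
  ((continuous_clock_integrand hu₁ hY hYI).integral_hasStrictDerivAt 0 u).hasDerivAt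

/-- The rate is positive. [folklore] -/
theorem rate_pos (hu₁ : 0 ≤ u₁) (hYI : ∀ u ∈ Icc 0 u₁, Y u ∈ Ioo 0 (2 * π)) (u : ℝ) :
    0 < rate Y u₁ u :=
  div_pos (mul_pos four_pos (pow_pos (sin_half_Ycl_pos hu₁ hYI u) 4)) (pow_pos (imP_pos u) 2)

/-- `τ' = 1/a`. [folklore] -/
theorem hasDerivAt_clock' (hu₁ : 0 ≤ u₁) (hY : ContinuousOn Y (Icc 0 u₁))
    (hYI : ∀ u ∈ Icc 0 u₁, Y u ∈ Ioo 0 (2 * π)) (u : ℝ) :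
    HasDerivAt (clock Y u₁) (rate Y u₁ u)⁻¹ u := by
  convert hasDerivAt_clock hu₁ hY hYI u using 1
  rw [rate, inv_div]

/-- The clock is strictly increasing. [folklore] -/
theorem strictMono_clock (hu₁ : 0 ≤ u₁) (hY : ContinuousOn Y (Icc 0 u₁))
    (hYI : ∀ u ∈ Icc 0 u₁, Y u ∈ Ioo 0 (2 * π)) : StrictMono (clock Y u₁) :=
  strictMono_of_hasDerivAt_pos (fun u ↦ hasDerivAt_clock' hu₁ hY hYI u)
    fun u ↦ inv_pos.2 (rate_pos hu₁ hYI u)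

/-- The clock is continuous. [folklore] -/
theorem continuous_clock (hu₁ : 0 ≤ u₁) (hY : ContinuousOn Y (Icc 0 u₁))
    (hYI : ∀ u ∈ Icc 0 u₁, Y u ∈ Ioo 0 (2 * π)) : Continuous (clock Y u₁) :=
  continuous_iff_continuousAt.2 fun u ↦ (hasDerivAt_clock hu₁ hY hYI u).continuousAt

/-- The clock vanishes at time `0`. [folklore] -/
theorem clock_zero : clock Y u₁ 0 = 0 := by
  simp [clock]

/-- `ζ' = R' + i 𝒴'`. [folklore] -/
theorem hasDerivAt_centre (hu₁ : 0 ≤ u₁) (hY : ContinuousOn Y (Icc 0 u₁))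
    (hYI : ∀ u ∈ Icc 0 u₁, Y u ∈ Ioo 0 (2 * π)) (u : ℝ) :
    HasDerivAt (centre Y u₁)
      (((-(imP Y u₁ u * Real.cos (Ycl Y u₁ u / 2) / (2 * Real.sin (Ycl Y u₁ u / 2) ^ 3)) : ℝ) : ℂ) +
        ((-(imP Y u₁ u / (2 * Real.sin (Ycl Y u₁ u / 2) ^ 2)) : ℝ) : ℂ) * I) u := by
  have h1 := (hasDerivAt_reP hu₁ hY hYI u).ofReal_comp
  have h2 := ((hasDerivAt_imP hu₁ hY hYI u).ofReal_comp).mul_const I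
  exact h1.add h2

/-- `λ' = i cot(Y/2) λ`. [folklore] -/
theorem hasDerivAt_lamb (hu₁ : 0 ≤ u₁) (hY : ContinuousOn Y (Icc 0 u₁))
    (hYI : ∀ u ∈ Icc 0 u₁, Y u ∈ Ioo 0 (2 * π)) (u : ℝ) :
    HasDerivAt (lamb Y u₁) ((Real.cot (Ycl Y u₁ u / 2) : ℂ) * I * lamb Y u₁ u) u := by
  have h1 := ((hasDerivAt_phase hu₁ hY hYI u).ofReal_comp).mul_const I
  have h2 := (h1.cexp).neg
  refine h2.congr_deriv ?_
  rw [lamb]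
  ring

/-- `|λ| = 1`. [folklore] -/
theorem norm_lamb (u : ℝ) : ‖lamb Y u₁ u‖ = 1 := by
  rw [lamb, norm_neg, Complex.norm_exp_ofReal_mul_I]

/-- `λ ≠ 0`. [folklore] -/
theorem lamb_ne_zero (u : ℝ) : lamb Y u₁ u ≠ 0 :=
  norm_ne_zero_iff.1 (by rw [norm_lamb]; exact one_ne_zero)

/-- At time `0`: `ζ₀ = i`. [folklore] -/
theorem centre_zero : centre Y u₁ 0 = I := by
  simp [centre, reP_zero, imP_zero]

/-- At time `0`: `λ₀ = -1` (so `moebius ζ₀ λ₀ = toDisc`). [folklore] -/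
theorem lamb_zero : lamb Y u₁ 0 = -1 := by
  simp [lamb, phase_zero]

/-- `cot(π/2) = 0`. [folklore] -/
theorem _root_.Real.cot_pi_div_two : Real.cot (π / 2) = 0 := by
  rw [Real.cot_eq_cos_div_sin, Real.cos_pi_div_two, zero_div]

/-- At time `0`, if `Y₀ = π`: `W₀ = 0`. [folklore] -/
theorem drv_zero (hu₁ : 0 ≤ u₁) (h0 : Y 0 = π) : drv Y u₁ 0 = 0 := by
  simp [drv, reP_zero, imP_zero, Ycl_zero hu₁, h0, Real.cot_pi_div_two]

end Calculus


/-! ### Complex algebra of the atoms `P(-k ± i)` -/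

section Atoms

/-- `(P(-k + i)) (P(-k - i)) = P² (k² + 1)`. [folklore] -/
theorem atom_mul_atom (P k : ℝ) :
    ((P : ℂ) * (-(k : ℂ) + I)) * ((P : ℂ) * (-(k : ℂ) - I)) = ((P ^ 2 * (k ^ 2 + 1) : ℝ) : ℂ) := by
  push_cast
  ring_nf
  rw [Complex.I_sq]
  ring

/-- `P(-k + i) ≠ 0` for `P ≠ 0`. [folklore] -/
theorem atom_ne_zero {P : ℝ} (hP : P ≠ 0) (k : ℝ) : (P : ℂ) * (-(k : ℂ) + I) ≠ 0 := by
  refine mul_ne_zero (Complex.ofReal_ne_zero.2 hP) ?_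
  intro h
  have := congrArg Complex.im h
  simp at this

/-- `P(-k - i) ≠ 0` for `P ≠ 0`. [folklore] -/
theorem atom'_ne_zero {P : ℝ} (hP : P ≠ 0) (k : ℝ) : (P : ℂ) * (-(k : ℂ) - I) ≠ 0 := by
  refine mul_ne_zero (Complex.ofReal_ne_zero.2 hP) ?_
  intro h
  have := congrArg Complex.im h
  simp at this

/-- The Möbius rate of the atoms: `-(2Pi)²/((P(-k+i))² (P(-k-i))²) = 4/(P²(k²+1)²)`. [folklore] -/
theorem moebiusRate_atoms {P : ℝ} (hP : P ≠ 0) (k : ℝ) :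
    -((2 * P : ℝ) * I) ^ 2 / (((P : ℂ) * (-(k : ℂ) + I)) ^ 2 * ((P : ℂ) * (-(k : ℂ) - I)) ^ 2) =
      ((4 / (P ^ 2 * (k ^ 2 + 1) ^ 2) : ℝ) : ℂ) := by
  have hk : (k ^ 2 + 1 : ℝ) ≠ 0 := by positivity
  rw [show ((P : ℂ) * (-(k : ℂ) + I)) ^ 2 * ((P : ℂ) * (-(k : ℂ) - I)) ^ 2 =
      (((P : ℂ) * (-(k : ℂ) + I)) * ((P : ℂ) * (-(k : ℂ) - I))) ^ 2 by ring, atom_mul_atom]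
  have hnum : -((2 * P : ℝ) * I) ^ 2 = ((4 * P ^ 2 : ℝ) : ℂ) := by
    push_cast; ring_nf; rw [Complex.I_sq]; ring
  rw [hnum]
  push_cast
  have hP' : (P : ℂ) ≠ 0 := Complex.ofReal_ne_zero.2 hP
  have hk' : ((k : ℂ) ^ 2 + 1) ≠ 0 := by exact_mod_cast hk
  field_simp

/-- The chordal rate of the centre read through the atoms:
`2/(P(-k+i)) / (4/(P²(k²+1)²)) = -Pk(k²+1)/2 - i P(k²+1)/2`. [folklore] -/
theorem two_div_atom_div_rate {P : ℝ} (hP : P ≠ 0) (k : ℝ) :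
    2 / ((P : ℂ) * (-(k : ℂ) + I)) / (((4 / (P ^ 2 * (k ^ 2 + 1) ^ 2) : ℝ) : ℂ)) =
      ((-(P * k * (k ^ 2 + 1) / 2) : ℝ) : ℂ) + ((-(P * (k ^ 2 + 1) / 2) : ℝ) : ℂ) * I := by
  have hk : (k ^ 2 + 1 : ℝ) ≠ 0 := by positivity
  have hP' : (P : ℂ) ≠ 0 := Complex.ofReal_ne_zero.2 hP
  have hk' : ((k : ℂ) ^ 2 + 1) ≠ 0 := by exact_mod_cast hk
  have hx := atom_ne_zero hP k
  have ha : (((4 / (P ^ 2 * (k ^ 2 + 1) ^ 2) : ℝ) : ℂ)) ≠ 0 := Complex.ofReal_ne_zero.2 (by positivity)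
  rw [div_div, div_eq_iff (mul_ne_zero hx ha)]
  push_cast
  field_simp
  ring_nf
  rw [Complex.I_sq]
  ring

/-- The same for the conjugate atom: `2/(P(-k-i)) / (4/(P²(k²+1)²)) = -Pk(k²+1)/2 + i P(k²+1)/2`.
[folklore] -/
theorem two_div_atom'_div_rate {P : ℝ} (hP : P ≠ 0) (k : ℝ) :
    2 / ((P : ℂ) * (-(k : ℂ) - I)) / (((4 / (P ^ 2 * (k ^ 2 + 1) ^ 2) : ℝ) : ℂ)) =
      ((-(P * k * (k ^ 2 + 1) / 2) : ℝ) : ℂ) - ((-(P * (k ^ 2 + 1) / 2) : ℝ) : ℂ) * I := by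
  have hk : (k ^ 2 + 1 : ℝ) ≠ 0 := by positivity
  have hP' : (P : ℂ) ≠ 0 := Complex.ofReal_ne_zero.2 hP
  have hk' : ((k : ℂ) ^ 2 + 1) ≠ 0 := by exact_mod_cast hk
  have hx := atom'_ne_zero hP k
  have ha : (((4 / (P ^ 2 * (k ^ 2 + 1) ^ 2) : ℝ) : ℂ)) ≠ 0 := Complex.ofReal_ne_zero.2 (by positivity)
  rw [div_div, div_eq_iff (mul_ne_zero hx ha)]
  push_cast
  field_simp
  ring_nf
  rw [Complex.I_sq]
  ring

/-- The phase rate read through the atoms: `((P(-k+i))⁻² - (P(-k-i))⁻²)/(4/(P²(k²+1)²)) = i k`.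
[folklore] -/
theorem atom_inv_sq_sub_div_rate {P : ℝ} (hP : P ≠ 0) (k : ℝ) :
    (((P : ℂ) * (-(k : ℂ) + I))⁻¹ ^ 2 - ((P : ℂ) * (-(k : ℂ) - I))⁻¹ ^ 2) /
        (((4 / (P ^ 2 * (k ^ 2 + 1) ^ 2) : ℝ) : ℂ)) = (k : ℂ) * I := by
  have hk : (k ^ 2 + 1 : ℝ) ≠ 0 := by positivity
  have hP' : (P : ℂ) ≠ 0 := Complex.ofReal_ne_zero.2 hP
  have hk' : ((k : ℂ) ^ 2 + 1) ≠ 0 := by exact_mod_cast hk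
  have hx := atom_ne_zero hP k
  have hxb := atom'_ne_zero hP k
  have ha : (((4 / (P ^ 2 * (k ^ 2 + 1) ^ 2) : ℝ) : ℂ)) ≠ 0 := Complex.ofReal_ne_zero.2 (by positivity)
  have e1 : ((P : ℂ) * (-(k : ℂ) + I))⁻¹ ^ 2 - ((P : ℂ) * (-(k : ℂ) - I))⁻¹ ^ 2 =
      (((P : ℂ) * (-(k : ℂ) - I)) ^ 2 - ((P : ℂ) * (-(k : ℂ) + I)) ^ 2) /
        (((P : ℂ) * (-(k : ℂ) + I)) * ((P : ℂ) * (-(k : ℂ) - I))) ^ 2 := by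
    have h1 : (-(k : ℂ) + I) ≠ 0 := fun h ↦ hx (by rw [h, mul_zero])
    have h2 : (-(k : ℂ) - I) ≠ 0 := fun h ↦ hxb (by rw [h, mul_zero])
    field_simp
  have e2 : ((P : ℂ) * (-(k : ℂ) - I)) ^ 2 - ((P : ℂ) * (-(k : ℂ) + I)) ^ 2 = ((4 * P ^ 2 * k : ℝ) : ℂ) * I := by
    push_cast; ring
  rw [e1, e2, atom_mul_atom, div_eq_iff ha]
  push_cast
  field_simp

/-- `(k - i)/(k + i) = exp(-y i)` for `k = cot(y/2)`, `sin(y/2) ≠ 0`. [folklore] -/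
theorem cot_sub_I_div_cot_add_I {y : ℝ} (hs : Real.sin (y / 2) ≠ 0) :
    ((Real.cot (y / 2) : ℂ) - I) / ((Real.cot (y / 2) : ℂ) + I) = Complex.exp (-(y : ℂ) * I) := by
  have hs' : (Real.sin (y / 2) : ℂ) ≠ 0 := Complex.ofReal_ne_zero.2 hs
  have h1 : ((Real.cot (y / 2) : ℂ) - I) / ((Real.cot (y / 2) : ℂ) + I) =
      ((Real.cos (y / 2) : ℂ) - (Real.sin (y / 2) : ℂ) * I) /
        ((Real.cos (y / 2) : ℂ) + (Real.sin (y / 2) : ℂ) * I) := by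
    rw [Real.cot_eq_cos_div_sin, Complex.ofReal_div, div_sub' hs', div_add' _ _ _ hs',
      div_div_div_cancel_right₀ hs', mul_comm I]
  have hc : (Real.cos (y / 2) : ℂ) + (Real.sin (y / 2) : ℂ) * I = Complex.exp (((y / 2 : ℝ) : ℂ) * I) := by
    rw [Complex.exp_mul_I, ← Complex.ofReal_cos, ← Complex.ofReal_sin]
  have hc' : (Real.cos (y / 2) : ℂ) - (Real.sin (y / 2) : ℂ) * I = Complex.exp (((-(y / 2) : ℝ) : ℂ) * I) := by
    rw [Complex.exp_mul_I, ← Complex.ofReal_cos, ← Complex.ofReal_sin, Real.cos_neg, Real.sin_neg]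
    push_cast
    ring
  rw [h1, hc, hc', ← Complex.exp_sub]
  congr 1
  push_cast
  ring

end Atoms

/-! ### The Möbius data at a fixed time -/

section MoebiusData

variable {Y : ℝ → ℝ} {u₁ : ℝ}

/-- The conjugate centre `ζ̄_u = R_u - i 𝒴_u`. [folklore] -/
def ccentre (Y : ℝ → ℝ) (u₁ : ℝ) (u : ℝ) : ℂ := (reP Y u₁ u : ℂ) - (imP Y u₁ u : ℂ) * I

/-- `conj ζ = ζ̄`. [folklore] -/
theorem conj_centre (u : ℝ) : conj (centre Y u₁ u) = ccentre Y u₁ u := by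
  simp only [centre, ccentre, map_add, map_mul, Complex.conj_ofReal, Complex.conj_I]
  ring

/-- `im ζ = 𝒴 > 0`. [folklore] -/
theorem centre_im (u : ℝ) : (centre Y u₁ u).im = imP Y u₁ u := by
  simp [centre]

/-- `ζ - W = 𝒴 (-cot(Y/2) + i)`. [folklore] -/
theorem centre_sub_drv (u : ℝ) :
    centre Y u₁ u - (drv Y u₁ u : ℂ) = (imP Y u₁ u : ℂ) * (-(Real.cot (Ycl Y u₁ u / 2) : ℂ) + I) := by
  simp only [centre, drv]
  push_cast
  ring

/-- `ζ̄ - W = 𝒴 (-cot(Y/2) - i)`. [folklore] -/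
theorem ccentre_sub_drv (u : ℝ) :
    ccentre Y u₁ u - (drv Y u₁ u : ℂ) = (imP Y u₁ u : ℂ) * (-(Real.cot (Ycl Y u₁ u / 2) : ℂ) - I) := by
  simp only [ccentre, drv]
  push_cast
  ring

/-- `ζ - ζ̄ = 2 i 𝒴`. [folklore] -/
theorem centre_sub_ccentre (u : ℝ) :
    centre Y u₁ u - ccentre Y u₁ u = ((2 * imP Y u₁ u : ℝ) : ℂ) * I := by
  simp only [centre, ccentre]
  push_cast
  ring

/-- `1 + cot² = 1/sin²` along the path, in the form `cot² + 1 = (sin²)⁻¹`. [folklore] -/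
theorem cot_sq_add_one (hu₁ : 0 ≤ u₁) (hYI : ∀ u ∈ Icc 0 u₁, Y u ∈ Ioo 0 (2 * π)) (u : ℝ) :
    Real.cot (Ycl Y u₁ u / 2) ^ 2 + 1 = (Real.sin (Ycl Y u₁ u / 2) ^ 2)⁻¹ := by
  have hs := (sin_half_Ycl_pos hu₁ hYI u).ne'
  rw [Real.cot_eq_cos_div_sin, div_pow, div_add_one (pow_ne_zero 2 hs), Real.cos_sq_add_sin_sq, one_div]

/-- **The rate in terms of the cotangent**: `a = 4/(𝒴² (cot²+1)²)`. [folklore] -/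
theorem rate_eq_cot (hu₁ : 0 ≤ u₁) (hYI : ∀ u ∈ Icc 0 u₁, Y u ∈ Ioo 0 (2 * π)) (u : ℝ) :
    rate Y u₁ u = 4 / (imP Y u₁ u ^ 2 * (Real.cot (Ycl Y u₁ u / 2) ^ 2 + 1) ^ 2) := by
  rw [rate, cot_sq_add_one hu₁ hYI u]
  have hs := (sin_half_Ycl_pos hu₁ hYI u).ne'
  have hP := (imP_pos (Y := Y) (u₁ := u₁) u).ne'
  field_simp

/-- **The rate is the Möbius rate**: `a = -(ζ - ζ̄)²/((ζ - W)²(ζ̄ - W)²)`. [folklore] -/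
theorem rate_eq_moebiusRate (hu₁ : 0 ≤ u₁) (hYI : ∀ u ∈ Icc 0 u₁, Y u ∈ Ioo 0 (2 * π)) (u : ℝ) :
    (rate Y u₁ u : ℂ) = -(centre Y u₁ u - ccentre Y u₁ u) ^ 2 /
      ((centre Y u₁ u - (drv Y u₁ u : ℂ)) ^ 2 * (ccentre Y u₁ u - (drv Y u₁ u : ℂ)) ^ 2) := by
  rw [centre_sub_ccentre, centre_sub_drv, ccentre_sub_drv,
    moebiusRate_atoms (imP_pos (Y := Y) (u₁ := u₁) u).ne', rate_eq_cot hu₁ hYI u]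

/-- `R' = -𝒴 cos/(2 sin³) = -𝒴 k (k²+1)/2` with `k = cot(Y/2)`. [folklore] -/
theorem reP_deriv_eq_cot (hu₁ : 0 ≤ u₁) (hYI : ∀ u ∈ Icc 0 u₁, Y u ∈ Ioo 0 (2 * π)) (u : ℝ) :
    -(imP Y u₁ u * Real.cos (Ycl Y u₁ u / 2) / (2 * Real.sin (Ycl Y u₁ u / 2) ^ 3)) =
      -(imP Y u₁ u * Real.cot (Ycl Y u₁ u / 2) * (Real.cot (Ycl Y u₁ u / 2) ^ 2 + 1) / 2) := by
  rw [cot_sq_add_one hu₁ hYI u, Real.cot_eq_cos_div_sin]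
  have hs := (sin_half_Ycl_pos hu₁ hYI u).ne'
  field_simp

/-- `𝒴' = -𝒴/(2 sin²) = -𝒴 (k²+1)/2` with `k = cot(Y/2)`. [folklore] -/
theorem imP_deriv_eq_cot (hu₁ : 0 ≤ u₁) (hYI : ∀ u ∈ Icc 0 u₁, Y u ∈ Ioo 0 (2 * π)) (u : ℝ) :
    -(imP Y u₁ u / (2 * Real.sin (Ycl Y u₁ u / 2) ^ 2)) =
      -(imP Y u₁ u * (Real.cot (Ycl Y u₁ u / 2) ^ 2 + 1) / 2) := by
  rw [cot_sq_add_one hu₁ hYI u]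
  have hs := (sin_half_Ycl_pos hu₁ hYI u).ne'
  field_simp

/-- **The centre moves by the chordal field at the target, divided by the rate**:
`ζ' = 2/((ζ - W) a)`. [cite: SchrammWilson2005, §4] -/
theorem hasDerivAt_centre' (hu₁ : 0 ≤ u₁) (hY : ContinuousOn Y (Icc 0 u₁))
    (hYI : ∀ u ∈ Icc 0 u₁, Y u ∈ Ioo 0 (2 * π)) (u : ℝ) :
    HasDerivAt (centre Y u₁) (2 / (centre Y u₁ u - (drv Y u₁ u : ℂ)) / (rate Y u₁ u : ℂ)) u := by
  convert hasDerivAt_centre hu₁ hY hYI u using 1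
  rw [centre_sub_drv, rate_eq_cot hu₁ hYI u, two_div_atom_div_rate (imP_pos (Y := Y) (u₁ := u₁) u).ne',
    reP_deriv_eq_cot hu₁ hYI u, imP_deriv_eq_cot hu₁ hYI u]

/-- **The conjugate centre moves by the chordal field divided by the rate**:
`ζ̄' = 2/((ζ̄ - W) a)`. [cite: SchrammWilson2005, §4] -/
theorem hasDerivAt_ccentre (hu₁ : 0 ≤ u₁) (hY : ContinuousOn Y (Icc 0 u₁))
    (hYI : ∀ u ∈ Icc 0 u₁, Y u ∈ Ioo 0 (2 * π)) (u : ℝ) :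
    HasDerivAt (ccentre Y u₁) (2 / (ccentre Y u₁ u - (drv Y u₁ u : ℂ)) / (rate Y u₁ u : ℂ)) u := by
  have h1 := (hasDerivAt_reP hu₁ hY hYI u).ofReal_comp
  have h2 := ((hasDerivAt_imP hu₁ hY hYI u).ofReal_comp).mul_const I
  have h : HasDerivAt (ccentre Y u₁)
      (((-(imP Y u₁ u * Real.cos (Ycl Y u₁ u / 2) / (2 * Real.sin (Ycl Y u₁ u / 2) ^ 3)) : ℝ) : ℂ) -
        ((-(imP Y u₁ u / (2 * Real.sin (Ycl Y u₁ u / 2) ^ 2)) : ℝ) : ℂ) * I) u := h1.sub h2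
  convert h using 1
  rw [ccentre_sub_drv, rate_eq_cot hu₁ hYI u, two_div_atom'_div_rate (imP_pos (Y := Y) (u₁ := u₁) u).ne',
    reP_deriv_eq_cot hu₁ hYI u, imP_deriv_eq_cot hu₁ hYI u]

/-- **The phase factor moves by the Möbius rate**: `λ' = ((ζ - W)⁻² - (ζ̄ - W)⁻²) λ / a`.
[cite: SchrammWilson2005, §4] -/
theorem hasDerivAt_lamb' (hu₁ : 0 ≤ u₁) (hY : ContinuousOn Y (Icc 0 u₁))
    (hYI : ∀ u ∈ Icc 0 u₁, Y u ∈ Ioo 0 (2 * π)) (u : ℝ) :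
    HasDerivAt (lamb Y u₁)
      (((centre Y u₁ u - (drv Y u₁ u : ℂ))⁻¹ ^ 2 - (ccentre Y u₁ u - (drv Y u₁ u : ℂ))⁻¹ ^ 2) /
        (rate Y u₁ u : ℂ) * lamb Y u₁ u) u := by
  convert hasDerivAt_lamb hu₁ hY hYI u using 1
  rw [centre_sub_drv, ccentre_sub_drv, rate_eq_cot hu₁ hYI u,
    atom_inv_sq_sub_div_rate (imP_pos (Y := Y) (u₁ := u₁) u).ne']

/-- The real driving value is fixed by conjugation. [folklore] -/
theorem conj_drv (u : ℝ) : conj (drv Y u₁ u : ℂ) = drv Y u₁ u := Complex.conj_ofReal _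

/-- `W - ζ̄ ≠ 0`. [folklore] -/
theorem drv_sub_ccentre_ne_zero (u : ℝ) : (drv Y u₁ u : ℂ) - ccentre Y u₁ u ≠ 0 := by
  rw [← neg_sub, neg_ne_zero, ccentre_sub_drv]
  exact atom'_ne_zero (imP_pos (Y := Y) (u₁ := u₁) u).ne' _

/-- `W - ζ ≠ 0`. [folklore] -/
theorem drv_sub_centre_ne_zero (u : ℝ) : (drv Y u₁ u : ℂ) - centre Y u₁ u ≠ 0 := by
  rw [← neg_sub, neg_ne_zero, centre_sub_drv]
  exact atom_ne_zero (imP_pos (Y := Y) (u₁ := u₁) u).ne' _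

/-- `ζ - ζ̄ ≠ 0`. [folklore] -/
theorem centre_sub_ccentre_ne_zero (u : ℝ) : centre Y u₁ u - ccentre Y u₁ u ≠ 0 := by
  rw [centre_sub_ccentre]
  exact mul_ne_zero (Complex.ofReal_ne_zero.2 (mul_ne_zero two_ne_zero (imP_pos u).ne')) Complex.I_ne_zero

/-- **The pole is on the unit circle**: `|moebius ζ λ W| = 1`. [folklore] -/
theorem norm_moebius_drv (u : ℝ) : ‖moebius (centre Y u₁ u) (lamb Y u₁ u) (drv Y u₁ u)‖ = 1 := by
  refine norm_moebius_of_conj_eq (conj_drv u) (norm_lamb u) ?_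
  rw [conj_centre]
  exact drv_sub_ccentre_ne_zero u

/-- **The pole of the conjugated motion is the rotated phase factor**:
`moebius ζ λ W = λ exp(-i Y)`. [cite: SchrammWilson2005, §4] -/
theorem moebius_drv (hu₁ : 0 ≤ u₁) (hYI : ∀ u ∈ Icc 0 u₁, Y u ∈ Ioo 0 (2 * π)) (u : ℝ) :
    moebius (centre Y u₁ u) (lamb Y u₁ u) (drv Y u₁ u) =
      lamb Y u₁ u * Complex.exp (-(Ycl Y u₁ u : ℂ) * I) := by
  have hP := (imP_pos (Y := Y) (u₁ := u₁) u).ne'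
  have hP' : (imP Y u₁ u : ℂ) ≠ 0 := Complex.ofReal_ne_zero.2 hP
  rw [moebius, conj_centre, mul_div_assoc]
  congr 1
  have h1 : (drv Y u₁ u : ℂ) - centre Y u₁ u = (imP Y u₁ u : ℂ) * ((Real.cot (Ycl Y u₁ u / 2) : ℂ) - I) := by
    rw [← neg_sub, centre_sub_drv]; ring
  have h2 : (drv Y u₁ u : ℂ) - ccentre Y u₁ u = (imP Y u₁ u : ℂ) * ((Real.cot (Ycl Y u₁ u / 2) : ℂ) + I) := by
    rw [← neg_sub, ccentre_sub_drv]; ring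
  rw [h1, h2, mul_div_mul_left _ _ hP', cot_sub_I_div_cot_add_I (sin_half_Ycl_pos hu₁ hYI u).ne']

/-- A point of the open unit disc is not the (unit) phase factor. [folklore] -/
theorem sub_lamb_ne_zero {G : ℂ} (hG : ‖G‖ < 1) (u : ℝ) : G - lamb Y u₁ u ≠ 0 := by
  intro h
  have : ‖G‖ = 1 := by rw [sub_eq_zero.1 h, norm_lamb]
  rw [this] at hG
  exact lt_irrefl _ hG

/-- A point of the open unit disc is not the pole. [folklore] -/
theorem pole_numerator_ne_zero {G : ℂ} (hG : ‖G‖ < 1) (u : ℝ) :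
    lamb Y u₁ u * ((drv Y u₁ u : ℂ) - centre Y u₁ u) - ((drv Y u₁ u : ℂ) - ccentre Y u₁ u) * G ≠ 0 := by
  have hWc := drv_sub_ccentre_ne_zero (Y := Y) (u₁ := u₁) u
  intro h
  have hG' : G = moebius (centre Y u₁ u) (lamb Y u₁ u) (drv Y u₁ u) := by
    rw [moebius, conj_centre, eq_div_iff hWc]
    linear_combination -h
  have h1 := norm_moebius_drv (Y := Y) (u₁ := u₁) u
  rw [← hG'] at h1
  rw [h1] at hG
  exact lt_irrefl _ hG

/-- For `im ζ > 0`: `|z - ζ|² < |z - ζ̄|²` iff `im z > 0`. [folklore] -/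
theorem normSq_sub_lt_normSq_sub_conj_iff {ζ z : ℂ} (hζ : 0 < ζ.im) :
    normSq (z - ζ) < normSq (z - conj ζ) ↔ 0 < z.im := by
  simp only [Complex.normSq_apply, Complex.sub_re, Complex.sub_im, Complex.conj_re, Complex.conj_im]
  constructor
  · intro h; nlinarith
  · intro h; nlinarith

/-- **The preimage of a disc point lies in the upper half-plane**: for `|G| < 1`,
`im (moebiusInv ζ λ G) > 0`. [folklore] -/
theorem im_moebiusInv_pos {G : ℂ} (hG : ‖G‖ < 1) (u : ℝ) :
    0 < (moebiusInv (centre Y u₁ u) (lamb Y u₁ u) G).im := by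
  set z := moebiusInv (centre Y u₁ u) (lamb Y u₁ u) G with hz
  have hζim : 0 < (centre Y u₁ u).im := by rw [centre_im]; exact imP_pos u
  have hζ : centre Y u₁ u - conj (centre Y u₁ u) ≠ 0 := by
    rw [conj_centre]; exact centre_sub_ccentre_ne_zero u
  have hmz : moebius (centre Y u₁ u) (lamb Y u₁ u) z = G :=
    moebius_moebiusInv (lamb_ne_zero u) hζ (sub_lamb_ne_zero hG u)
  have hzc : z - conj (centre Y u₁ u) ≠ 0 := by
    rw [hz, moebiusInv, div_sub' (sub_lamb_ne_zero hG u)]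
    refine div_ne_zero ?_ (sub_lamb_ne_zero hG u)
    have : conj (centre Y u₁ u) * G - lamb Y u₁ u * centre Y u₁ u - (G - lamb Y u₁ u) * conj (centre Y u₁ u) =
        lamb Y u₁ u * (conj (centre Y u₁ u) - centre Y u₁ u) := by ring
    rw [this]
    exact mul_ne_zero (lamb_ne_zero u) (fun h ↦ hζ (by linear_combination -h))
  -- if `im z ≤ 0` then `|moebius z| ≥ 1`
  by_contra hle
  push Not at hle
  have hge : normSq (z - conj (centre Y u₁ u)) ≤ normSq (z - centre Y u₁ u) := by
    by_contra hlt
    push Not at hlt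
    exact absurd ((normSq_sub_lt_normSq_sub_conj_iff hζim).1 hlt) (not_lt.2 hle)
  have hnorm : ‖z - conj (centre Y u₁ u)‖ ≤ ‖z - centre Y u₁ u‖ := by
    rw [Complex.normSq_eq_norm_sq, Complex.normSq_eq_norm_sq] at hge
    exact (pow_le_pow_iff_left₀ (norm_nonneg _) (norm_nonneg _) two_ne_zero).1 hge
  have h1 : 1 ≤ ‖moebius (centre Y u₁ u) (lamb Y u₁ u) z‖ := by
    rw [moebius, norm_div, norm_mul, norm_lamb, one_mul, le_div_iff₀ (norm_pos_iff.2 hzc), one_mul]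
    exact hnorm
  rw [hmz] at h1
  linarith

end MoebiusData


/-! ### The inverse conjugation identity, inlined form -/

/-- `inv_conj_identity` with all abbreviations expanded (the form used for rewriting).
[cite: Lawler2005, §4.2] -/
theorem inv_conj_identity' {G W ζ c lam : ℂ} (hGl : G - lam ≠ 0) (hζW : ζ - W ≠ 0) (hcW : c - W ≠ 0)
    (hWc : W - c ≠ 0) (hζc : ζ - c ≠ 0)
    (hN₁ : lam * (W - ζ) - (W - c) * G ≠ 0)
    (hN₂ : c * G - lam * ζ - (G - lam) * W ≠ 0) :
    ((2 / (c - W) / (-(ζ - c) ^ 2 / ((ζ - W) ^ 2 * (c - W) ^ 2)) * G +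
          c * (G * (lam * (W - ζ) / (W - c) + G) / (lam * (W - ζ) / (W - c) - G)) -
          ((ζ - W)⁻¹ ^ 2 - (c - W)⁻¹ ^ 2) / (-(ζ - c) ^ 2 / ((ζ - W) ^ 2 * (c - W) ^ 2)) * lam * ζ -
          lam * (2 / (ζ - W) / (-(ζ - c) ^ 2 / ((ζ - W) ^ 2 * (c - W) ^ 2)))) * (G - lam) -
        (c * G - lam * ζ) *
          (G * (lam * (W - ζ) / (W - c) + G) / (lam * (W - ζ) / (W - c) - G) -
            ((ζ - W)⁻¹ ^ 2 - (c - W)⁻¹ ^ 2) / (-(ζ - c) ^ 2 / ((ζ - W) ^ 2 * (c - W) ^ 2)) * lam)) /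
        (G - lam) ^ 2 =
      2 / ((c * G - lam * ζ) / (G - lam) - W) / (-(ζ - c) ^ 2 / ((ζ - W) ^ 2 * (c - W) ^ 2)) :=
  inv_conj_identity hGl hζW hcW hWc hζc hN₁ hN₂

/-! ### The radial Bessel equation: phase and driving point -/

section Driving

variable {Y : ℝ → ℝ} {u₁ : ℝ} {V : ℝ≥0 → ℝ}

/-- On `[0, u₁]` the phase is the raw integral `∫₀ᵘ cot(Y_s/2) ds`. [folklore] -/
theorem phase_eq_integral {u : ℝ} (hu : u ∈ Icc 0 u₁) :
    phase Y u₁ u = ∫ s in (0 : ℝ)..u, Real.cot (Y s / 2) := by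
  rw [phase]
  refine intervalIntegral.integral_congr fun s hs ↦ ?_
  rw [uIcc_of_le hu.1] at hs
  rw [Ycl_of_mem ⟨hs.1, hs.2.trans hu.2⟩]

/-- **The phase is the marked angle plus the driving angle minus `π`**: if `Y` solves the radial
Bessel equation `Y_u = π + ∫₀ᵘ cot(Y_s/2) ds - V_u` on `[0, u₁]` (Lawler (2005), (6.12), for the
boundary point `-1 = e^{iπ}` and the driving angle `V`, `V₀ = 0`), then `ϑ_u = Y_u + V_u - π` there.
[cite: Lawler2005, §6.4 eq. (6.12)] -/
theorem phase_eq
    (hYeq : ∀ u ∈ Icc 0 u₁, Y u = π + (∫ s in (0 : ℝ)..u, Real.cot (Y s / 2)) - V u.toNNReal)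
    {u : ℝ} (hu : u ∈ Icc 0 u₁) :
    phase Y u₁ u = Y u + V u.toNNReal - π := by
  rw [phase_eq_integral hu, hYeq u hu]
  ring

/-- `exp(-π i) = -1`. [folklore] -/
theorem exp_neg_pi_mul_I : Complex.exp (-(π : ℂ) * I) = -1 := by
  rw [neg_mul, Complex.exp_neg, Complex.exp_pi_mul_I]
  norm_num

/-- **The pole of the conjugated motion is the radial driving point**: under the radial Bessel
equation, `moebius ζ_u λ_u W_u = e^{iV_u}` for `u ∈ [0, u₁]`. [cite: SchrammWilson2005, §4] -/
theorem moebius_drv_eq_exp (hu₁ : 0 ≤ u₁) (hYI : ∀ u ∈ Icc 0 u₁, Y u ∈ Ioo 0 (2 * π))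
    (hYeq : ∀ u ∈ Icc 0 u₁, Y u = π + (∫ s in (0 : ℝ)..u, Real.cot (Y s / 2)) - V u.toNNReal)
    {u : ℝ} (hu : u ∈ Icc 0 u₁) :
    moebius (centre Y u₁ u) (lamb Y u₁ u) (drv Y u₁ u) = Complex.exp ((V u.toNNReal : ℝ) * I) := by
  rw [moebius_drv hu₁ hYI u, lamb, phase_eq hYeq hu, Ycl_of_mem hu, neg_mul, ← Complex.exp_add]
  have h : (((Y u + V u.toNNReal - π : ℝ)) : ℂ) * I + -(Y u : ℂ) * I =
      ((V u.toNNReal : ℝ) : ℂ) * I + -(π : ℂ) * I := by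
    push_cast; ring
  rw [h, Complex.exp_add, exp_neg_pi_mul_I]
  ring

/-- The radial driving point of the tree's radial chain is the pole:
`RadialLoewner.Disc.drivingPt V u = moebius ζ_u λ_u W_u`. [cite: SchrammWilson2005, §4] -/
theorem drivingPt_eq_moebius (hu₁ : 0 ≤ u₁) (hYI : ∀ u ∈ Icc 0 u₁, Y u ∈ Ioo 0 (2 * π))
    (hYeq : ∀ u ∈ Icc 0 u₁, Y u = π + (∫ s in (0 : ℝ)..u, Real.cot (Y s / 2)) - V u.toNNReal)
    {u : ℝ} (hu : u ∈ Icc 0 u₁) :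
    RadialLoewner.Disc.drivingPt V u = moebius (centre Y u₁ u) (lamb Y u₁ u) (drv Y u₁ u) := by
  rw [RadialLoewner.Disc.drivingPt, moebius_drv_eq_exp hu₁ hYI hYeq hu]

end Driving

/-! ### Conjugated radial solutions solve the chordal equation (radial time) -/

section Conjugation

variable {Y : ℝ → ℝ} {u₁ : ℝ} {V : ℝ≥0 → ℝ}

/-- **The conjugation theorem (infinitesimal form).** Let `Y` solve the radial Bessel equation of
the marked point on `[0, u₁]` and let `G` solve the radial Loewner equation of `RadialLoewner.Disc`
(driving point `e^{iV}`) at a time `u ∈ [0, u₁]` within a set of times `S`, with `|G_u| < 1`.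
Then the preimage `z_s = moebiusInv ζ_s λ_s G_s` solves, at `u` within `S`, the **chordal Loewner
equation in radial time**: `ż = 2/((z - W_u) a_u)`, `W_u` the chordal driving value and `a_u` the
rate (Schramm–Wilson (2005), §4: the chordal picture of radial SLE; here for an arbitrary
continuous driving function, pathwise). [cite: SchrammWilson2005, §4] -/
theorem hasDerivWithinAt_moebiusInv (hu₁ : 0 ≤ u₁) (hY : ContinuousOn Y (Icc 0 u₁))
    (hYI : ∀ u ∈ Icc 0 u₁, Y u ∈ Ioo 0 (2 * π))
    (hYeq : ∀ u ∈ Icc 0 u₁, Y u = π + (∫ s in (0 : ℝ)..u, Real.cot (Y s / 2)) - V u.toNNReal)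
    {G : ℝ → ℂ} {S : Set ℝ} {u : ℝ} (hu : u ∈ Icc 0 u₁) (hG1 : ‖G u‖ < 1)
    (hG : HasDerivWithinAt G (RadialLoewner.Disc.field V u (G u)) S u) :
    HasDerivWithinAt (fun s ↦ moebiusInv (centre Y u₁ s) (lamb Y u₁ s) (G s))
      (2 / (moebiusInv (centre Y u₁ u) (lamb Y u₁ u) (G u) - (drv Y u₁ u : ℂ)) / (rate Y u₁ u : ℂ)) S u := by
  -- the pieces and their derivatives within `S` at `u`
  have hc := (hasDerivAt_ccentre hu₁ hY hYI u).hasDerivWithinAt (s := S)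
  have hζ := (hasDerivAt_centre' hu₁ hY hYI u).hasDerivWithinAt (s := S)
  have hl := (hasDerivAt_lamb' hu₁ hY hYI u).hasDerivWithinAt (s := S)
  have hD0 : G u - lamb Y u₁ u ≠ 0 := sub_lamb_ne_zero hG1 u
  have hN := (hc.mul hG).sub (hl.mul hζ)
  have hD := hG.sub hl
  have hq := hN.div hD hD0
  have hfun : (fun s ↦ moebiusInv (centre Y u₁ s) (lamb Y u₁ s) (G s)) =
      fun s ↦ (ccentre Y u₁ s * G s - lamb Y u₁ s * centre Y u₁ s) / (G s - lamb Y u₁ s) := by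
    funext s; rw [moebiusInv, conj_centre]
  rw [hfun]
  refine hq.congr_deriv ?_
  simp only [Pi.sub_apply, Pi.mul_apply]
  -- the algebra: rewrite everything in Möbius form and apply the inverse identity
  rw [moebiusInv_apply, conj_centre, RadialLoewner.Disc.field_apply, drivingPt_eq_moebius hu₁ hYI hYeq hu,
    moebius_apply, conj_centre, rate_eq_moebiusRate hu₁ hYI u]
  have hWc : (drv Y u₁ u : ℂ) - ccentre Y u₁ u ≠ 0 := drv_sub_ccentre_ne_zero u
  have hζW : centre Y u₁ u - (drv Y u₁ u : ℂ) ≠ 0 := fun h ↦ drv_sub_centre_ne_zero (Y := Y) (u₁ := u₁) u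
    (by linear_combination -h)
  have hcW : ccentre Y u₁ u - (drv Y u₁ u : ℂ) ≠ 0 := fun h ↦ hWc (by linear_combination -h)
  have hζc : centre Y u₁ u - ccentre Y u₁ u ≠ 0 := centre_sub_ccentre_ne_zero u
  have hN₁ := pole_numerator_ne_zero (Y := Y) (u₁ := u₁) hG1 u
  have hN₂ : ccentre Y u₁ u * G u - lamb Y u₁ u * centre Y u₁ u - (G u - lamb Y u₁ u) * (drv Y u₁ u : ℂ) ≠ 0 := by
    have him := im_moebiusInv_pos (Y := Y) (u₁ := u₁) hG1 u
    rw [moebiusInv_apply, conj_centre] at him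
    intro h
    have h' : (ccentre Y u₁ u * G u - lamb Y u₁ u * centre Y u₁ u) / (G u - lamb Y u₁ u) = drv Y u₁ u := by
      rw [div_eq_iff hD0]; linear_combination h
    rw [h'] at him
    simp at him
  rw [← inv_conj_identity' hD0 hζW hcW hWc hζc hN₁ hN₂]
  ring

end Conjugation


/-! ### The inverse clock (radial time as a function of chordal time) -/

section InverseClock

variable {Y : ℝ → ℝ} {u₁ : ℝ}

/-- The **inverse clock** `υ`: the radial time at which the chordal clock reaches `t`, for levels
`t ∈ [τ(-1), τ(u₁ + 1)]` (clamped outside; `Function.invFunOn` of the clock on `[-1, u₁ + 1]`).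
Hypothesis-free definition; its properties (`clock_invClock`, `invClock_clock`,
`continuous_invClock`, `hasDerivAt_invClock`) hold for a continuous angle path in `(0, 2π)`.
[cite: SchrammWilson2005, §4] -/
def invClock (Y : ℝ → ℝ) (u₁ : ℝ) (t : ℝ) : ℝ :=
  Function.invFunOn (clock Y u₁) (Icc (-1) (u₁ + 1))
    (max (clock Y u₁ (-1)) (min t (clock Y u₁ (u₁ + 1))))

variable (hu₁ : 0 ≤ u₁) (hY : ContinuousOn Y (Icc 0 u₁)) (hYI : ∀ u ∈ Icc 0 u₁, Y u ∈ Ioo 0 (2 * π))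
include hu₁ hY hYI

/-- The clamped level lies in the range of the clock on `[-1, u₁ + 1]`. [folklore] -/
theorem exists_clock_eq_clampLevel (t : ℝ) :
    ∃ u ∈ Icc (-1 : ℝ) (u₁ + 1), clock Y u₁ u = max (clock Y u₁ (-1)) (min t (clock Y u₁ (u₁ + 1))) := by
  have hle : (-1 : ℝ) ≤ u₁ + 1 := by linarith
  have hivt := intermediate_value_Icc hle ((continuous_clock hu₁ hY hYI).continuousOn)
  have hmem : max (clock Y u₁ (-1)) (min t (clock Y u₁ (u₁ + 1))) ∈
      Icc (clock Y u₁ (-1)) (clock Y u₁ (u₁ + 1)) := by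
    have hmono := (strictMono_clock hu₁ hY hYI).monotone hle
    exact ⟨le_max_left _ _, max_le hmono (min_le_right _ _)⟩
  exact hivt hmem

/-- **The clock inverts the inverse clock** at every clamped level. [folklore] -/
theorem clock_invClock (t : ℝ) :
    clock Y u₁ (invClock Y u₁ t) = max (clock Y u₁ (-1)) (min t (clock Y u₁ (u₁ + 1))) :=
  Function.invFunOn_eq (exists_clock_eq_clampLevel hu₁ hY hYI t)

/-- The inverse clock takes values in `[-1, u₁ + 1]`. [folklore] -/
theorem invClock_mem (t : ℝ) : invClock Y u₁ t ∈ Icc (-1 : ℝ) (u₁ + 1) :=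
  Function.invFunOn_mem (exists_clock_eq_clampLevel hu₁ hY hYI t)

/-- For levels in the range, `τ (υ t) = t`. [folklore] -/
theorem clock_invClock_of_mem {t : ℝ} (ht : t ∈ Icc (clock Y u₁ (-1)) (clock Y u₁ (u₁ + 1))) :
    clock Y u₁ (invClock Y u₁ t) = t := by
  rw [clock_invClock hu₁ hY hYI, min_eq_left ht.2, max_eq_right ht.1]

/-- **The inverse clock inverts the clock** on `[-1, u₁ + 1]`. [folklore] -/
theorem invClock_clock {u : ℝ} (hu : u ∈ Icc (-1 : ℝ) (u₁ + 1)) : invClock Y u₁ (clock Y u₁ u) = u := by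
  have hmono := (strictMono_clock hu₁ hY hYI).monotone
  have ht : clock Y u₁ u ∈ Icc (clock Y u₁ (-1)) (clock Y u₁ (u₁ + 1)) := ⟨hmono hu.1, hmono hu.2⟩
  exact (strictMono_clock hu₁ hY hYI).injective (clock_invClock_of_mem hu₁ hY hYI ht)

/-- The clock is negative before time `0` and exceeds `τ u₁` after `u₁`: the levels `[0, τ u₁]` lie
strictly inside the range `(τ(-1), τ(u₁+1))`. [folklore] -/
theorem Icc_subset_Ioo_clock :
    Icc 0 (clock Y u₁ u₁) ⊆ Ioo (clock Y u₁ (-1)) (clock Y u₁ (u₁ + 1)) := by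
  intro t ht
  have h1 : clock Y u₁ (-1) < clock Y u₁ 0 := strictMono_clock hu₁ hY hYI (by norm_num)
  have h2 : clock Y u₁ u₁ < clock Y u₁ (u₁ + 1) := strictMono_clock hu₁ hY hYI (by linarith)
  rw [clock_zero] at h1
  exact ⟨h1.trans_le ht.1, ht.2.trans_lt h2⟩

/-- **The clock is a homeomorphism of `[-1, u₁ + 1]` onto its image interval.** [folklore] -/
theorem exists_homeomorph_clock :
    ∃ e : Icc (-1 : ℝ) (u₁ + 1) ≃ₜ Icc (clock Y u₁ (-1)) (clock Y u₁ (u₁ + 1)),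
      ∀ u : Icc (-1 : ℝ) (u₁ + 1), (e u : ℝ) = clock Y u₁ u := by
  have hle : (-1 : ℝ) ≤ u₁ + 1 := by linarith
  have hcont := continuous_clock hu₁ hY hYI
  have hmono := (strictMono_clock hu₁ hY hYI).monotone
  set g : Icc (-1 : ℝ) (u₁ + 1) → Icc (clock Y u₁ (-1)) (clock Y u₁ (u₁ + 1)) := fun u ↦
    ⟨clock Y u₁ u, hmono u.2.1, hmono u.2.2⟩ with hg
  have hgc : Continuous g := (hcont.comp continuous_subtype_val).subtype_mk _
  have hinj : Function.Injective g := fun s t hst ↦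
    Subtype.ext ((strictMono_clock hu₁ hY hYI).injective (congrArg Subtype.val hst))
  have hsurj : Function.Surjective g := by
    intro v
    obtain ⟨u, hu, huv⟩ := intermediate_value_Icc hle (hcont.continuousOn) v.2
    exact ⟨⟨u, hu⟩, Subtype.ext huv⟩
  have hec : Continuous (Equiv.ofBijective g ⟨hinj, hsurj⟩) := hgc
  exact ⟨hec.homeoOfEquivCompactToT2, fun u ↦ rfl⟩

/-- **The inverse clock is continuous.** [folklore] -/
theorem continuous_invClock : Continuous (invClock Y u₁) := by
  obtain ⟨e, he⟩ := exists_homeomorph_clock hu₁ hY hYI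
  have hle' : clock Y u₁ (-1) ≤ clock Y u₁ (u₁ + 1) := (strictMono_clock hu₁ hY hYI).monotone (by linarith)
  set cap : ℝ → Icc (clock Y u₁ (-1)) (clock Y u₁ (u₁ + 1)) := fun t ↦
    ⟨max (clock Y u₁ (-1)) (min t (clock Y u₁ (u₁ + 1))), le_max_left _ _, max_le hle' (min_le_right _ _)⟩
    with hcap
  have hcapc : Continuous cap := (continuous_const.max (continuous_id.min continuous_const)).subtype_mk _
  have hformula : invClock Y u₁ = fun t ↦ ((e.symm (cap t) : Icc (-1 : ℝ) (u₁ + 1)) : ℝ) := by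
    funext t
    apply (strictMono_clock hu₁ hY hYI).injective
    rw [clock_invClock hu₁ hY hYI, ← he (e.symm (cap t)), Homeomorph.apply_symm_apply]
  rw [hformula]
  exact continuous_subtype_val.comp (e.symm.continuous.comp hcapc)

/-- **The inverse clock is differentiable with derivative the rate**: `υ'(t) = a(υ t)` for levels
`t` strictly inside the range (inverse function rule). [folklore] -/
theorem hasDerivAt_invClock {t : ℝ} (ht : t ∈ Ioo (clock Y u₁ (-1)) (clock Y u₁ (u₁ + 1))) :
    HasDerivAt (invClock Y u₁) (rate Y u₁ (invClock Y u₁ t)) t := by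
  have hinv : (rate Y u₁ (invClock Y u₁ t))⁻¹ ≠ 0 := inv_ne_zero (rate_pos hu₁ hYI _).ne'
  have h := HasDerivAt.of_local_left_inverse (continuous_invClock hu₁ hY hYI).continuousAt
    (hasDerivAt_clock' hu₁ hY hYI (invClock Y u₁ t)) hinv ?_
  · simpa using h
  · filter_upwards [isOpen_Ioo.mem_nhds ht] with s hs
    exact clock_invClock_of_mem hu₁ hY hYI ⟨hs.1.le, hs.2.le⟩

/-- The inverse clock is monotone. [folklore] -/
theorem monotone_invClock : Monotone (invClock Y u₁) := by
  intro s t hst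
  by_contra hlt
  push Not at hlt
  have h := strictMono_clock hu₁ hY hYI hlt
  rw [clock_invClock hu₁ hY hYI, clock_invClock hu₁ hY hYI] at h
  have : max (clock Y u₁ (-1)) (min s (clock Y u₁ (u₁ + 1))) ≤ max (clock Y u₁ (-1)) (min t (clock Y u₁ (u₁ + 1))) :=
    max_le_max le_rfl (min_le_min hst le_rfl)
  exact absurd h (not_lt.2 this)

/-- `υ 0 = 0`. [folklore] -/
theorem invClock_zero : invClock Y u₁ 0 = 0 := by
  have h := invClock_clock hu₁ hY hYI (u := 0) ⟨by norm_num, by linarith⟩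
  rwa [clock_zero] at h

/-- On `[0, τ u₁]` the inverse clock takes values in `[0, u₁]`. [folklore] -/
theorem invClock_mem_Icc {t : ℝ} (ht : t ∈ Icc 0 (clock Y u₁ u₁)) : invClock Y u₁ t ∈ Icc 0 u₁ := by
  have h0 := monotone_invClock hu₁ hY hYI ht.1
  have h1 := monotone_invClock hu₁ hY hYI ht.2
  rw [invClock_zero hu₁ hY hYI] at h0
  rw [invClock_clock hu₁ hY hYI ⟨by linarith, by linarith⟩] at h1
  exact ⟨h0, h1⟩

end InverseClock


/-! ### The chordal driving function in capacity time and the conjugated chordal solutions -/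

section Chordal

variable {Y : ℝ → ℝ} {u₁ : ℝ} {V : ℝ≥0 → ℝ}

/-- The **chordal driving function in capacity time** `W̌_t = W_{υ t}` (Schramm–Wilson (2005), §4:
the driving function of the chordal Loewner chain obtained from the radial one by the Möbius map;
defined on all of `ℝ≥0`, frozen junk beyond the level `τ(u₁ + 1)`). [cite: SchrammWilson2005, §4] -/
def cdrv (Y : ℝ → ℝ) (u₁ : ℝ) (t : ℝ≥0) : ℝ := drv Y u₁ (invClock Y u₁ t)

/-- The chordal clock at a nonnegative radial time, as an element of `ℝ≥0`. [folklore] -/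
def clockNN (Y : ℝ → ℝ) (u₁ : ℝ) (u : ℝ≥0) : ℝ≥0 := (clock Y u₁ u).toNNReal

/-- The **conjugated chordal solution** attached to a radial solution `G`:
`Z_t = moebiusInv ζ_{υt} λ_{υt} G_{υt}`. [cite: SchrammWilson2005, §4] -/
def conjSol (Y : ℝ → ℝ) (u₁ : ℝ) (G : ℝ → ℂ) (t : ℝ) : ℂ :=
  moebiusInv (centre Y u₁ (invClock Y u₁ t)) (lamb Y u₁ (invClock Y u₁ t)) (G (invClock Y u₁ t))

/-- `moebiusInv i (-1) = toHalf`. [folklore] -/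
theorem moebiusInv_I_neg_one (w : ℂ) : moebiusInv I (-1) w = toHalf w := by
  rw [moebiusInv, toHalf, Complex.conj_I]
  ring_nf

variable (hu₁ : 0 ≤ u₁) (hY : ContinuousOn Y (Icc 0 u₁)) (hYI : ∀ u ∈ Icc 0 u₁, Y u ∈ Ioo 0 (2 * π))
include hu₁ hY hYI

/-- The chordal driving function is continuous. [folklore] -/
theorem continuous_cdrv : Continuous (cdrv Y u₁) := by
  have hdrv : Continuous (drv Y u₁) :=
    (continuous_reP hu₁ hY hYI).add ((continuous_imP hu₁ hY hYI).mul (continuous_cot_half hu₁ hY hYI))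
  exact hdrv.comp ((continuous_invClock hu₁ hY hYI).comp NNReal.continuous_coe)

/-- For a nonnegative radial time the clock is nonnegative, so `clockNN` is the clock. [folklore] -/
theorem coe_clockNN (u : ℝ≥0) : (clockNN Y u₁ u : ℝ) = clock Y u₁ u := by
  rw [clockNN, Real.coe_toNNReal]
  have := (strictMono_clock hu₁ hY hYI).monotone (show (0 : ℝ) ≤ u from u.coe_nonneg)
  rwa [clock_zero] at this

/-- The clock in `ℝ≥0` is strictly increasing. [folklore] -/
theorem clockNN_lt_clockNN {u u' : ℝ≥0} (h : u < u') : clockNN Y u₁ u < clockNN Y u₁ u' := by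
  rw [← NNReal.coe_lt_coe, coe_clockNN hu₁ hY hYI, coe_clockNN hu₁ hY hYI]
  exact strictMono_clock hu₁ hY hYI (NNReal.coe_lt_coe.2 h)

/-- At the clock of a radial time `u ∈ [0, u₁]` the chordal driver is `W_u`. [folklore] -/
theorem cdrv_clockNN {u : ℝ≥0} (hu : (u : ℝ) ≤ u₁) : cdrv Y u₁ (clockNN Y u₁ u) = drv Y u₁ u := by
  rw [cdrv, coe_clockNN hu₁ hY hYI, invClock_clock hu₁ hY hYI ⟨by linarith [u.coe_nonneg], by linarith⟩]

/-- `W̌₀ = 0` when `Y₀ = π` (radial chain started at the driving point `1 = toDisc 0`). [folklore] -/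
theorem cdrv_zero (h0 : Y 0 = π) : cdrv Y u₁ 0 = 0 := by
  rw [cdrv, NNReal.coe_zero, invClock_zero hu₁ hY hYI, drv_zero hu₁ h0]

/-- **The conjugated solution solves the chordal Loewner equation in capacity time.** Let `Y` solve
the radial Bessel equation of the marked point on `[0, u₁]`, let `G` solve the radial Loewner
equation of `RadialLoewner.Disc` (driver `V`) from `w`, `|w| < 1`, with lifetime `T`, and let
`0 ≤ u' ≤ u₁` with `u' ≤ T`. Then `Z = conjSol G` solves the chordal Loewner equation of the tree
(`Loewner.IsSolution`) driven by `W̌ = cdrv` from `toHalf w` with lifetime `τ u'`.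
[cite: SchrammWilson2005, §4] -/
theorem isSolution_conjSol (hV : Continuous V)
    (hYeq : ∀ u ∈ Icc 0 u₁, Y u = π + (∫ s in (0 : ℝ)..u, Real.cot (Y s / 2)) - V u.toNNReal)
    {w : ℂ} (hw : ‖w‖ < 1) {G : ℝ → ℂ} {T : WithTop ℝ≥0} (hG : RadialLoewner.Disc.IsSolution V w G T)
    {u' : ℝ≥0} (hu' : (u' : ℝ) ≤ u₁) (hu'T : (u' : WithTop ℝ≥0) ≤ T) :
    Loewner.IsSolution (cdrv Y u₁) (toHalf w) (conjSol Y u₁ G) (clockNN Y u₁ u') := by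
  refine ⟨?_, fun t ht ↦ ?_, fun t ht0 htT ↦ ?_⟩
  · -- initial value
    rw [conjSol, invClock_zero hu₁ hY hYI, centre_zero, lamb_zero, hG.apply_zero, moebiusInv_I_neg_one]
  · -- the equation within the chordal time domain
    obtain ⟨ht0, htT⟩ := ht
    have htT' : t < clock Y u₁ u' := by
      have := WithTop.coe_lt_coe.1 htT
      rw [← NNReal.coe_lt_coe, Real.coe_toNNReal _ ht0, coe_clockNN hu₁ hY hYI] at this
      exact this
    -- the radial time `s = υ t ∈ [0, u')`
    set s := invClock Y u₁ t with hs
    have htmem : t ∈ Icc 0 (clock Y u₁ u₁) :=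
      ⟨ht0, htT'.le.trans ((strictMono_clock hu₁ hY hYI).monotone hu')⟩
    have hsI : s ∈ Icc 0 u₁ := invClock_mem_Icc hu₁ hY hYI htmem
    have hsu' : s < u' := by
      by_contra hle
      push Not at hle
      have := (strictMono_clock hu₁ hY hYI).monotone hle
      rw [hs, clock_invClock_of_mem hu₁ hY hYI (Ioo_subset_Icc_self (Icc_subset_Ioo_clock hu₁ hY hYI htmem))]
        at this
      exact absurd htT' (not_lt.2 this)
    have hsT : ((s.toNNReal : ℝ≥0) : WithTop ℝ≥0) < T := by
      refine lt_of_lt_of_le (WithTop.coe_lt_coe.2 ?_) hu'T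
      rw [← NNReal.coe_lt_coe, Real.coe_toNNReal _ hsI.1]
      exact hsu'
    have hsdom : s ∈ RadialLoewner.Disc.timeDom T := ⟨hsI.1, hsT⟩
    -- the radial equation at `s`, conjugated
    have hGs : HasDerivWithinAt G (RadialLoewner.Disc.field V s (G s)) (RadialLoewner.Disc.timeDom T) s :=
      hG.isIntegralCurveOn s hsdom
    have hG1 : ‖G s‖ < 1 := hG.norm_lt_one hV hw hsI.1 hsT
    have hF := hasDerivWithinAt_moebiusInv hu₁ hY hYI hYeq hsI hG1 hGs
    -- composed with the inverse clock
    have hυ : HasDerivWithinAt (invClock Y u₁) (rate Y u₁ s)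
        {t : ℝ | 0 ≤ t ∧ ((t.toNNReal : ℝ≥0) : WithTop ℝ≥0) < clockNN Y u₁ u'} t :=
      (hasDerivAt_invClock hu₁ hY hYI (Icc_subset_Ioo_clock hu₁ hY hYI htmem)).hasDerivWithinAt
    have hmaps : MapsTo (invClock Y u₁) {t : ℝ | 0 ≤ t ∧ ((t.toNNReal : ℝ≥0) : WithTop ℝ≥0) < clockNN Y u₁ u'}
        (RadialLoewner.Disc.timeDom T) := by
      intro r hr
      have hrT' : r < clock Y u₁ u' := by
        have := WithTop.coe_lt_coe.1 hr.2
        rw [← NNReal.coe_lt_coe, Real.coe_toNNReal _ hr.1, coe_clockNN hu₁ hY hYI] at this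
        exact this
      have hrmem : r ∈ Icc 0 (clock Y u₁ u₁) :=
        ⟨hr.1, hrT'.le.trans ((strictMono_clock hu₁ hY hYI).monotone hu')⟩
      have hrI := invClock_mem_Icc hu₁ hY hYI hrmem
      have hru' : invClock Y u₁ r < u' := by
        by_contra hle
        push Not at hle
        have := (strictMono_clock hu₁ hY hYI).monotone hle
        rw [clock_invClock_of_mem hu₁ hY hYI (Ioo_subset_Icc_self (Icc_subset_Ioo_clock hu₁ hY hYI hrmem))]
          at this
        exact absurd hrT' (not_lt.2 this)
      refine ⟨hrI.1, lt_of_lt_of_le (WithTop.coe_lt_coe.2 ?_) hu'T⟩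
      rw [← NNReal.coe_lt_coe, Real.coe_toNNReal _ hrI.1]
      exact hru'
    have hcomp := hF.scomp t hυ hmaps
    have hfun : ((fun s ↦ moebiusInv (centre Y u₁ s) (lamb Y u₁ s) (G s)) ∘ invClock Y u₁) = conjSol Y u₁ G := by
      funext r; rfl
    rw [hfun] at hcomp
    refine hcomp.congr_deriv ?_
    rw [Loewner.vectorField_apply, cdrv, Real.coe_toNNReal _ ht0, conjSol, Complex.real_smul, ← hs]
    have ha : (rate Y u₁ s : ℂ) ≠ 0 := Complex.ofReal_ne_zero.2 (rate_pos hu₁ hYI s).ne'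
    field_simp
  · -- the solution stays off the (real) driving function: it lies in the upper half-plane
    intro h
    have him := im_moebiusInv_pos (Y := Y) (u₁ := u₁) (G := G (invClock Y u₁ t))
      (hG.norm_lt_one hV hw ?_ ?_) (invClock Y u₁ t)
    · rw [← conjSol, h, Complex.ofReal_im] at him
      exact lt_irrefl _ him
    all_goals
      have htT' : t < clock Y u₁ u' := by
        have := WithTop.coe_lt_coe.1 htT
        rw [← NNReal.coe_lt_coe, Real.coe_toNNReal _ ht0, coe_clockNN hu₁ hY hYI] at this
        exact this
      have htmem : t ∈ Icc 0 (clock Y u₁ u₁) :=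
        ⟨ht0, htT'.le.trans ((strictMono_clock hu₁ hY hYI).monotone hu')⟩
      have hsI : invClock Y u₁ t ∈ Icc 0 u₁ := invClock_mem_Icc hu₁ hY hYI htmem
    · exact hsI.1
    · have hsu' : invClock Y u₁ t < u' := by
        by_contra hle
        push Not at hle
        have := (strictMono_clock hu₁ hY hYI).monotone hle
        rw [clock_invClock_of_mem hu₁ hY hYI (Ioo_subset_Icc_self (Icc_subset_Ioo_clock hu₁ hY hYI htmem))]
          at this
        exact absurd htT' (not_lt.2 this)
      refine lt_of_lt_of_le (WithTop.coe_lt_coe.2 ?_) hu'T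
      rw [← NNReal.coe_lt_coe, Real.coe_toNNReal _ hsI.1]
      exact hsu'

/-- **The chordal Loewner map evaluates the conjugated radial map.** For a radial time
`u < u₁` and a point `w` of the radial Loewner domain `D_u` (`RadialLoewner.Disc.domain`), the point
`toHalf w` lies in the chordal Loewner domain of `W̌` at the capacity time `τ u`, and
`g^{W̌}_{τu}(toHalf w) = moebiusInv ζ_u λ_u (g_u(w))` (Schramm–Wilson (2005), §4: the chordal
maps are the radial maps conjugated by the time-dependent Möbius map). [cite: SchrammWilson2005, §4] -/
theorem map_cdrv_toHalf (hV : Continuous V)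
    (hYeq : ∀ u ∈ Icc 0 u₁, Y u = π + (∫ s in (0 : ℝ)..u, Real.cot (Y s / 2)) - V u.toNNReal)
    {u : ℝ≥0} (hu : (u : ℝ) < u₁) {w : ℂ} (hw : w ∈ RadialLoewner.Disc.domain V u) :
    toHalf w ∈ Loewner.domain (cdrv Y u₁) (clockNN Y u₁ u) ∧
      Loewner.map (cdrv Y u₁) (clockNN Y u₁ u) (toHalf w) =
        moebiusInv (centre Y u₁ u) (lamb Y u₁ u) (RadialLoewner.Disc.map V u w) := by
  rw [RadialLoewner.Disc.mem_domain_iff] at hw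
  obtain ⟨hw1, hwT⟩ := hw
  rw [mem_ball_zero_iff] at hw1
  obtain ⟨G, hG⟩ := RadialLoewner.Disc.exists_isSolution_swallowingTime hV w
  -- a radial time `u' ∈ (u, u₁]` still before the swallowing time
  obtain ⟨u', huu', hu'1, hu'T⟩ : ∃ u' : ℝ≥0, u < u' ∧ (u' : ℝ) ≤ u₁ ∧
      (u' : WithTop ℝ≥0) ≤ RadialLoewner.Disc.swallowingTime V w := by
    induction hT : RadialLoewner.Disc.swallowingTime V w with
    | top =>
      refine ⟨⟨(u + u₁) / 2, by positivity⟩, ?_, ?_, le_top⟩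
      · rw [← NNReal.coe_lt_coe]; change (u : ℝ) < (u + u₁) / 2; linarith
      · change (u + u₁) / 2 ≤ u₁; linarith
    | coe t₀ =>
      rw [hT] at hwT
      have hut₀ : u < t₀ := WithTop.coe_lt_coe.1 hwT
      refine ⟨min ⟨(u + u₁) / 2, by positivity⟩ t₀, lt_min ?_ hut₀, ?_, WithTop.coe_le_coe.2 (min_le_right _ _)⟩
      · rw [← NNReal.coe_lt_coe]; change (u : ℝ) < (u + u₁) / 2; linarith
      · refine (NNReal.coe_le_coe.2 (min_le_left _ _)).trans ?_
        change (u + u₁) / 2 ≤ u₁; linarith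
  have hsol := isSolution_conjSol hu₁ hY hYI hV hYeq hw1 hG hu'1 hu'T
  have hlt : (clockNN Y u₁ u : WithTop ℝ≥0) < clockNN Y u₁ u' :=
    WithTop.coe_lt_coe.2 (clockNN_lt_clockNN hu₁ hY hYI huu')
  have hmap := Loewner.map_eq_of_isSolution (continuous_cdrv hu₁ hY hYI) hsol hlt
  have hu0 : (0 : ℝ) ≤ u := u.coe_nonneg
  refine ⟨?_, ?_⟩
  · rw [Loewner.mem_domain_iff]
    exact ⟨im_toHalf_pos hw1, hlt.trans_le hsol.le_swallowingTime⟩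
  · rw [hmap, conjSol, coe_clockNN hu₁ hY hYI, invClock_clock hu₁ hY hYI ⟨by linarith, by linarith⟩,
      RadialLoewner.Disc.map_eq_of_isSolution hV hG hwT]

/-- **The chordal Loewner domain is the image of the radial one**: at the capacity time `τ u`
(`u < u₁`), `Loewner.domain W̌ (τ u) = toHalf '' D_u`. The inclusion `⊇` is `map_cdrv_toHalf`;
for `⊆`, both Loewner maps are bijections onto `ℍ` resp. `𝔻` (`Loewner.bijOn_map`,
`RadialLoewner.Disc.bijOn_map`) intertwined by the Möbius map on the image of the radial
domain, so no other point of the chordal domain can have the same image.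
[cite: SchrammWilson2005, §4] -/
theorem domain_cdrv_eq (hV : Continuous V)
    (hYeq : ∀ u ∈ Icc 0 u₁, Y u = π + (∫ s in (0 : ℝ)..u, Real.cot (Y s / 2)) - V u.toNNReal)
    {u : ℝ≥0} (hu : (u : ℝ) < u₁) :
    Loewner.domain (cdrv Y u₁) (clockNN Y u₁ u) = toHalf '' RadialLoewner.Disc.domain V u := by
  have hWc := continuous_cdrv hu₁ hY hYI
  refine Subset.antisymm (fun z hz ↦ ?_) ?_
  · -- `⊆`
    set ω' := Loewner.map (cdrv Y u₁) (clockNN Y u₁ u) z with hω'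
    have hω'H : 0 < ω'.im := Loewner.mapsTo_map hWc _ hz
    have hζim : 0 < (centre Y u₁ u).im := by rw [centre_im]; exact imP_pos _
    have hw1 : ‖moebius (centre Y u₁ u) (lamb Y u₁ u) ω'‖ < 1 := by
      have := norm_moebius_lt hζim hω'H (lamb_ne_zero (Y := Y) (u₁ := u₁) u)
      rwa [norm_lamb] at this
    obtain ⟨w', hw'dom, hw'eq⟩ := (RadialLoewner.Disc.bijOn_map hV u).surjOn (mem_ball_zero_iff.2 hw1)
    obtain ⟨hmem, hmap⟩ := map_cdrv_toHalf hu₁ hY hYI hV hYeq hu hw'dom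
    rw [hw'eq, moebiusInv_moebius (lamb_ne_zero u) ?_ ?_] at hmap
    · have : toHalf w' = z := (Loewner.injOn_map hWc _) hmem hz (hmap.trans hω'.symm)
      exact ⟨w', hw'dom, this⟩
    · rw [conj_centre]; exact centre_sub_ccentre_ne_zero u
    · intro h
      have := congrArg Complex.im h
      simp [centre_im] at this
      linarith [imP_pos (Y := Y) (u₁ := u₁) u]
  · -- `⊇`
    rintro _ ⟨w, hw, rfl⟩
    exact (map_cdrv_toHalf hu₁ hY hYI hV hYeq hu hw).1

/-- **The radial inverse map through the chordal one**: for `|ω| < 1`,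
`g_u⁻¹(ω) = toDisc (g^{W̌}_{τu}⁻¹ (moebiusInv ζ_u λ_u ω))` (`u < u₁`), with the inverses read as
`Function.invFunOn` on the respective Loewner domains. [cite: SchrammWilson2005, §4] -/
theorem invFunOn_map_eq (hV : Continuous V)
    (hYeq : ∀ u ∈ Icc 0 u₁, Y u = π + (∫ s in (0 : ℝ)..u, Real.cot (Y s / 2)) - V u.toNNReal)
    {u : ℝ≥0} (hu : (u : ℝ) < u₁) {ω : ℂ} (hω : ‖ω‖ < 1) :
    Function.invFunOn (RadialLoewner.Disc.map V u) (RadialLoewner.Disc.domain V u) ω =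
      toDisc (Function.invFunOn (Loewner.map (cdrv Y u₁) (clockNN Y u₁ u))
        (Loewner.domain (cdrv Y u₁) (clockNN Y u₁ u)) (moebiusInv (centre Y u₁ u) (lamb Y u₁ u) ω)) := by
  have hWc := continuous_cdrv hu₁ hY hYI
  set w := Function.invFunOn (RadialLoewner.Disc.map V u) (RadialLoewner.Disc.domain V u) ω with hwdef
  have hex : ∃ w' ∈ RadialLoewner.Disc.domain V u, RadialLoewner.Disc.map V u w' = ω :=
    (RadialLoewner.Disc.bijOn_map hV u).surjOn (mem_ball_zero_iff.2 hω)
  have hwdom : w ∈ RadialLoewner.Disc.domain V u := Function.invFunOn_mem hex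
  have hweq : RadialLoewner.Disc.map V u w = ω := Function.invFunOn_eq hex
  obtain ⟨hmem, hmap⟩ := map_cdrv_toHalf hu₁ hY hYI hV hYeq hu hwdom
  rw [hweq] at hmap
  have hex' : ∃ z ∈ Loewner.domain (cdrv Y u₁) (clockNN Y u₁ u),
      Loewner.map (cdrv Y u₁) (clockNN Y u₁ u) z = moebiusInv (centre Y u₁ u) (lamb Y u₁ u) ω :=
    ⟨toHalf w, hmem, hmap⟩
  have hz := Function.invFunOn_mem hex'
  have hzeq := Function.invFunOn_eq hex'
  have heq : Function.invFunOn (Loewner.map (cdrv Y u₁) (clockNN Y u₁ u))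
      (Loewner.domain (cdrv Y u₁) (clockNN Y u₁ u)) (moebiusInv (centre Y u₁ u) (lamb Y u₁ u) ω) = toHalf w :=
    (Loewner.injOn_map hWc _) hz hmem (hzeq.trans hmap.symm)
  rw [heq, toDisc_toHalf]
  have hw1 : ‖w‖ < 1 := mem_ball_zero_iff.1 (RadialLoewner.Disc.domain_subset V u hwdom)
  exact one_add_ne_zero hw1

end Chordal

end RadialChordal

end Literature.Probability.RandomPlanarGeometry
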